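import Mathlib
import Summits.MatrixMultiplication.MatrixMultiplication.Theses.SemilatticeSTPP

/-!
# `SemilatticeSTPP.Assembly` (stmt-MatrixMultiplication-5976) — proved

The assembly item of route `MatrixMultiplication/SemilatticeSTPP` is the implication
`TPPRestriction → RegularMonoidRank → Thesis → MatrixMultiplication`:
a monoid-TPP restriction lemma, the rank bound `R(T_M) ≤ |M|` for commutative monoids with every
element regular (Clifford monoids), and the packing thesis X_M together decide `ω(ℂ) = 2`.

Proof (self-contained bookkeeping; it follows — but does not invoke — the route file's deciding
theorem `closes`): `ω(ℂ) ≥ 2` (`omega_two_le`), so if `ω(ℂ) ≠ 2` then `ω(ℂ) > 2`; take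
`ε := ω(ℂ) − 2 > 0` in `Thesis` to get a host `M` and a monoid-TPP family with
`|M| < Σ (aᵢbᵢcᵢ)^((2+ε)/3) = Σ (aᵢbᵢcᵢ)^(ω/3)`; `TPPRestriction` gives the restriction
`⊕⟨aᵢ,bᵢ,cᵢ⟩ ≤ T_M`, so `R(⊕⟨aᵢ,bᵢ,cᵢ⟩) ≤ R(T_M) ≤ |M|` (`TensorRestrictsTo.tensorRank_le`,
`RegularMonoidRank`), and Schönhage's asymptotic sum inequality for the rank
(`asymptoticSumInequality_rank`, Bläser 2013 Thm 7.5, proved in tree) gives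
`Σ (aᵢbᵢcᵢ)^(ω/3) ≤ |M|` — contradiction.
-/

-- single-conjunct summit: the mandated namespace `Summit.MatrixMultiplication.MatrixMultiplication.…`
-- repeats `MatrixMultiplication` (summit = sub-problem), which `linter.dupNamespace` would flag.
set_option linter.dupNamespace false

namespace Summit.MatrixMultiplication.MatrixMultiplication.Theorems

open Literature.Computability.AlgebraicComplexity

/-- **Assembly of route `SemilatticeSTPP` (stmt-MatrixMultiplication-5976), exact signature
`TPPRestriction → RegularMonoidRank → Thesis → MatrixMultiplication`.** If `ω(ℂ) ≠ 2` then
`ω(ℂ) > 2` (`omega_two_le`); with `ε := ω(ℂ) − 2` the thesis yields a Clifford host `M` and a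
monoid-TPP family with `|M| < Σ (aᵢbᵢcᵢ)^(ω/3)`, while restriction (`TPPRestriction`,
`TensorRestrictsTo.tensorRank_le`), the rank bound `RegularMonoidRank` and the asymptotic sum
inequality for the rank (`asymptoticSumInequality_rank`) give `Σ (aᵢbᵢcᵢ)^(ω/3) ≤ |M|`.
[folklore] -/
theorem semilatticeSTPP_assembly_proof :
    Summit.MatrixMultiplication.MatrixMultiplication.Theses.SemilatticeSTPP.Assembly := by
  unfold Summit.MatrixMultiplication.MatrixMultiplication.Theses.SemilatticeSTPP.Assembly
  intro hT hR hX
  show omega ℂ = 2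
  by_contra hne
  have h2 : (2 : ℝ) ≤ omega ℂ := omega_two_le ℂ
  have hgt : (2 : ℝ) < omega ℂ := lt_of_le_of_ne h2 (Ne.symm hne)
  obtain ⟨M, instM, instF, hreg, p, a, b, c, α, β, γ, htpp, hcard⟩ := hX (omega ℂ - 2) (by linarith)
  classical
  have hres := hT M p a b c α β γ htpp
  have hrank : tensorRank (matMulDirectSum ℂ a b c) ≤ Fintype.card M :=
    hres.tensorRank_le.trans (hR M hreg)
  have hasi := asymptoticSumInequality_rank ℂ a b c hrank
  have hexp : (2 + (omega ℂ - 2)) / 3 = omega ℂ / 3 := by ring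
  rw [hexp] at hcard
  linarith

end Summit.MatrixMultiplication.MatrixMultiplication.Theorems
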